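import Summits.CriticalPhenomena.PercolationContinuityZ3.Theorems.Transplant.BccSlabPaths
import HarnessLib

/-!
# Height profiles for lifted paths in the bcc (001)-slabs: admissibility along a lattice walk, the MONOTONE profile (elevators) and the
# BOUNCE profile (prescribed end height) — so that every planar leg of length `ℓ` lifts to a self-avoiding slab path between ANY two
# admissible end vertices over its end columns (`|Δh| ≤ ℓ`: bounce along a simple leg; `|Δh| > ℓ`: monotone, padding with a two-column elevator)

builds on p205010 (kernel theorem, internal audit signed; external expert review pending) — NOT used in this file.  Lane `prim-bschramm`, seat
`prim-bschramm-p2` (gen 45; class C1b; memo `HOME/bschramm/P2-LATTICES.md` §155 (4)); helper file (`--supports stmt-CriticalPhenomena-4575 --as helper`).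
* §1 `Profile` from local data: a lattice walk, unit height steps, heights in `[0, k]`, admissible at the start (`profile_of_walk` — parity propagates);
* §2 the bounce profile `bounceProf k h t n`: moves toward `t`, then oscillates next to `t`; stays in `[0, k]` (`k ≥ 1`), unit steps, and ENDS AT `t` whenever
  `|h − t| ≤ n` and `n − |h − t|` is even;
* §3 its monotone case (`|h − t| = n`): entries `h ± i`, duplicate-free (the elevator profile).
[cite: DuminilCopinSidoraviciusTassion2016, §2.3 (proof of Fact 2)] [cite: ConwaySloane1999, Ch. 4 §7.1]
-/

noncomputable section

namespace Summit.CriticalPhenomena.PercolationContinuityZ3.Theorems.Transplant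

namespace BccSlab

open Literature.Probability.Percolation Literature.Probability.LatticeModels SimpleGraph
open scoped Classical

variable {k : ℕ}

/-! ## §1 Admissibility propagates along a lattice walk -/

/-- Along a lattice bond of `ℤ²` the coordinate sum changes by `±1`. [folklore] -/
theorem sum_step_of_adj {p q : Site 2} (h : (zdGraph 2).Adj p q) : q 0 + q 1 = p 0 + p 1 + 1 ∨ q 0 + q 1 = p 0 + p 1 - 1 := by
  obtain ⟨j, hj | hj⟩ := (zdGraph_adj_iff _ _).1 h
  all_goals
    have c0 := congrFun hj 0; have c1 := congrFun hj 1
    simp only [Pi.add_apply] at c0 c1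
    fin_cases j <;> simp at c0 c1 <;> omega

/-- **A profile from local data**: same length, unit height steps, heights in `[0, k]`, consecutive columns lattice-adjacent, and admissibility at the START —
the parity condition then propagates along the walk. [folklore] -/
theorem profile_of_walk {π : List (Site 2)} {hs : List ℤ} (hlen : π.length = hs.length) (hwalk : π.IsChain (fun a b => (zdGraph 2).Adj a b))
    (hstep : ∀ (i : ℕ) (hi : i + 1 < hs.length), hs[i + 1] = hs[i]'(Nat.lt_of_succ_lt hi) + 1 ∨ hs[i + 1] = hs[i]'(Nat.lt_of_succ_lt hi) - 1)
    (hrange : ∀ (i : ℕ) (hi : i < hs.length), 0 ≤ hs[i] ∧ hs[i] ≤ k)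
    (h0 : ∀ (hπ : 0 < π.length) (hh : 0 < hs.length), Even (π[0] 0 + π[0] 1 - hs[0])) : Profile k π hs := by
  refine ⟨hlen, fun i => ?_, hstep⟩
  induction i with
  | zero => intro hi hi'; exact ⟨(hrange 0 hi').1, (hrange 0 hi').2, h0 hi hi'⟩
  | succ i ih =>
    intro hi hi'
    have hprev := (ih (Nat.lt_of_succ_lt hi) (Nat.lt_of_succ_lt hi')).2.2
    refine ⟨(hrange _ hi').1, (hrange _ hi').2, ?_⟩
    have hs1 := sum_step_of_adj (List.isChain_iff_getElem.1 hwalk i hi)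
    have hs2 := hstep i hi'
    obtain ⟨m, hm⟩ := hprev
    rcases hs1 with e | e <;> rcases hs2 with f | f
    · exact ⟨m, by rw [e, f]; omega⟩
    · exact ⟨m + 1, by rw [e, f]; omega⟩
    · exact ⟨m - 1, by rw [e, f]; omega⟩
    · exact ⟨m, by rw [e, f]; omega⟩

/-! ## §2 The bounce profile -/

/-- The next height when heading for `t` inside `[0, k]`: one step toward `t`, or (at `t`) one step to a neighbouring admissible height. [folklore] -/
def nxt (k : ℕ) (h t : ℤ) : ℤ := if h < t then h + 1 else if t < h then h - 1 else if h < k then h + 1 else h - 1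

/-- `nxt` is a unit step. [folklore] -/
theorem nxt_step (k : ℕ) (h t : ℤ) : nxt k h t = h + 1 ∨ nxt k h t = h - 1 := by
  unfold nxt; split_ifs <;> simp

/-- `nxt` stays in `[0, k]` (`k ≥ 1`, `h, t ∈ [0, k]`). [folklore] -/
theorem nxt_range (hk : 1 ≤ k) {h t : ℤ} (hh : 0 ≤ h ∧ h ≤ k) (ht : 0 ≤ t ∧ t ≤ k) : 0 ≤ nxt k h t ∧ nxt k h t ≤ k := by
  have hk' : (1 : ℤ) ≤ k := by exact_mod_cast hk
  unfold nxt; split_ifs <;> constructor <;> omega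

/-- `nxt` approaches `t`: the new distance is `|h − t| − 1` if `h ≠ t`, and `1` if `h = t`. [folklore] -/
theorem abs_nxt_sub (k : ℕ) (h t : ℤ) : |nxt k h t - t| = if h = t then 1 else |h - t| - 1 := by
  unfold nxt
  split_ifs with h1 h2 h3 h4 h5
  · omega
  · rw [abs_of_nonpos (by omega), abs_of_neg (by omega)]; ring
  · omega
  · rw [abs_of_nonneg (by omega), abs_of_pos (by omega)]; ring
  · rw [abs_of_pos (by omega)]; omega
  · omega
  · rw [abs_of_neg (by omega)]; omega
  · omega

/-- **The bounce profile** of `n + 1` heights starting at `h` and heading for `t`. [folklore] -/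
def bounceProf (k : ℕ) : ℤ → ℤ → ℕ → List ℤ
  | h, _, 0 => [h]
  | h, t, n + 1 => h :: bounceProf k (nxt k h t) t n

/-- Its length. [folklore] -/
@[simp] theorem length_bounceProf (k : ℕ) (h t : ℤ) (n : ℕ) : (bounceProf k h t n).length = n + 1 := by
  induction n generalizing h with
  | zero => rfl
  | succ n ih => simp [bounceProf, ih]

/-- It is non-empty. [folklore] -/
theorem bounceProf_ne_nil (k : ℕ) (h t : ℤ) (n : ℕ) : bounceProf k h t n ≠ [] := by
  intro e; have := congrArg List.length e; simp at this

/-- Its first entry. [folklore] -/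
theorem head_bounceProf (k : ℕ) (h t : ℤ) (n : ℕ) : (bounceProf k h t n).head (bounceProf_ne_nil k h t n) = h := by
  cases n <;> rfl

/-- Its zeroth entry. [folklore] -/
theorem getElem_zero_bounceProf (k : ℕ) (h t : ℤ) (n : ℕ) (h0 : 0 < (bounceProf k h t n).length) : (bounceProf k h t n)[0] = h := by
  cases n <;> rfl

/-- The tail entries are the entries of the shifted profile. [folklore] -/
theorem getElem_succ_bounceProf (k : ℕ) (h t : ℤ) (n i : ℕ) (hi : i + 1 < (bounceProf k h t (n + 1)).length) :
    (bounceProf k h t (n + 1))[i + 1] = (bounceProf k (nxt k h t) t n)[i]'(by simp at hi ⊢; omega) := by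
  simp [bounceProf]

/-- **Unit steps.** [folklore] -/
theorem step_bounceProf (k : ℕ) : ∀ (h t : ℤ) (n i : ℕ) (hi : i + 1 < (bounceProf k h t n).length),
    (bounceProf k h t n)[i + 1] = (bounceProf k h t n)[i]'(Nat.lt_of_succ_lt hi) + 1 ∨
      (bounceProf k h t n)[i + 1] = (bounceProf k h t n)[i]'(Nat.lt_of_succ_lt hi) - 1
  | h, t, 0, i, hi => by simp at hi
  | h, t, n + 1, 0, hi => by
    rw [getElem_succ_bounceProf, getElem_zero_bounceProf, getElem_zero_bounceProf]; exact nxt_step k h t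
  | h, t, n + 1, i + 1, hi => by
    rw [getElem_succ_bounceProf, getElem_succ_bounceProf]
    exact step_bounceProf k (nxt k h t) t n i (by simp at hi ⊢; omega)

/-- **It stays in `[0, k]`** (`k ≥ 1`, `h, t ∈ [0, k]`). [folklore] -/
theorem range_bounceProf (hk : 1 ≤ k) : ∀ (h t : ℤ) (n : ℕ), (0 ≤ h ∧ h ≤ k) → (0 ≤ t ∧ t ≤ k) →
    ∀ (i : ℕ) (hi : i < (bounceProf k h t n).length), 0 ≤ (bounceProf k h t n)[i] ∧ (bounceProf k h t n)[i] ≤ k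
  | h, t, 0, hh, _, i, hi => by
    have : i = 0 := by simp at hi; omega
    subst this; rw [getElem_zero_bounceProf]; exact hh
  | h, t, n + 1, hh, ht, 0, hi => by rw [getElem_zero_bounceProf]; exact hh
  | h, t, n + 1, hh, ht, i + 1, hi => by
    rw [getElem_succ_bounceProf]
    exact range_bounceProf hk (nxt k h t) t n (nxt_range hk hh ht) ht i (by simp at hi ⊢; omega)

/-- **It ends at `t`** when `t` is within reach with the right parity: `|h − t| ≤ n` and `n − |h − t|` even. [folklore] -/
theorem getLast_bounceProf (k : ℕ) : ∀ (h t : ℤ) (n : ℕ), |h - t| ≤ n → Even ((n : ℤ) - |h - t|) →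
    (bounceProf k h t n).getLast (bounceProf_ne_nil k h t n) = t
  | h, t, 0, hd, _ => by
    have : h = t := by have := abs_nonneg (h - t); have : |h - t| = 0 := by omega
                       exact sub_eq_zero.1 (abs_eq_zero.1 this)
    subst this; rfl
  | h, t, n + 1, hd, hp => by
    have e : bounceProf k h t (n + 1) = h :: bounceProf k (nxt k h t) t n := rfl
    simp only [e, List.getLast_cons (bounceProf_ne_nil k _ t n)]
    apply getLast_bounceProf k (nxt k h t) t n
    · rw [abs_nxt_sub]; split_ifs with he
      · subst he
        obtain ⟨m, hm⟩ := hp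
        rw [sub_self, abs_zero, sub_zero] at hm
        push_cast at hd ⊢; omega
      · push_cast at hd; omega
    · rw [abs_nxt_sub]; split_ifs with he
      · subst he
        obtain ⟨m, hm⟩ := hp
        rw [sub_self, abs_zero, sub_zero] at hm
        exact ⟨m - 1, by omega⟩
      · obtain ⟨m, hm⟩ := hp
        push_cast at hm
        exact ⟨m, by omega⟩

/-! ## §3 The monotone case: target exactly `n` away -/

/-- **When `t` is exactly `n` steps away the bounce profile is the monotone walk** `h ± i`. [folklore] -/
theorem getElem_bounceProf_mono (k : ℕ) : ∀ (h t : ℤ) (n : ℕ), |h - t| = n → ∀ (i : ℕ) (hi : i < (bounceProf k h t n).length),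
    (bounceProf k h t n)[i] = if h ≤ t then h + i else h - i
  | h, t, 0, _, i, hi => by
    have : i = 0 := by simp at hi; omega
    subst this; rw [getElem_zero_bounceProf]; split_ifs <;> simp
  | h, t, n + 1, _, 0, hi => by rw [getElem_zero_bounceProf]; split_ifs <;> simp
  | h, t, n + 1, hd, i + 1, hi => by
    rw [getElem_succ_bounceProf]
    have hne : h ≠ t := by
      intro e; subst e; rw [sub_self, abs_zero] at hd; push_cast at hd; omega
    have hd' : |nxt k h t - t| = n := by rw [abs_nxt_sub, if_neg hne, hd]; push_cast; ring
    rw [getElem_bounceProf_mono k (nxt k h t) t n hd' i (by simp at hi ⊢; omega)]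
    rcases lt_or_gt_of_ne hne with hlt | hgt
    · have e : nxt k h t = h + 1 := by unfold nxt; rw [if_pos hlt]
      rw [e, if_pos hlt.le, if_pos (by omega)]; push_cast; ring
    · have e : nxt k h t = h - 1 := by unfold nxt; rw [if_neg (not_lt.2 hgt.le), if_pos hgt]
      rw [e, if_neg (not_le.2 hgt)]
      simp only [length_bounceProf] at hi
      rw [e] at hd'
      push_cast
      split_ifs with hle
      · have hn : n = 0 := by
          have : h - 1 = t := le_antisymm hle (by omega)
          rw [this, sub_self, abs_zero] at hd'; omega
        subst hn; omega
      · ring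

/-- **In the monotone case the profile is duplicate-free** (so the lift is self-avoiding whatever the planar walk). [folklore] -/
theorem nodup_bounceProf_mono (k : ℕ) {h t : ℤ} {n : ℕ} (hd : |h - t| = n) : (bounceProf k h t n).Nodup := by
  rw [List.nodup_iff_injective_get]
  intro ⟨i, hi⟩ ⟨j, hj⟩ hij
  simp only [List.get_eq_getElem, getElem_bounceProf_mono k h t n hd] at hij
  apply Fin.ext
  show i = j
  split_ifs at hij <;> omega

end BccSlab

end Summit.CriticalPhenomena.PercolationContinuityZ3.Theorems.Transplant

end
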